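import Literature.ModelTheory.ExponentialFields.RealExpField
import Literature.ModelTheory.ExponentialFields.DecidableTheoryProofs
import Literature.ModelTheory.ProofTheory.ExistentialCodes
import Literature.ModelTheory.ProofTheory.CraigAxiomatization
import Literature.ModelTheory.ExponentialFields.ExistentialPreservation
import HarnessLib

/-!
# Macintyre–Wilkie: the decidability of `Th(ℝ_exp)` and its existential theory

Family `periods` (trunk T-TRANSCEND, group G06), topic `Literature/ModelTheory/ExponentialFields`,
in support of the named fact `Literature.ModelTheory.ExponentialFields.macintyre_wilkie` (**periods.S27**, `RealExpField.lean`):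

> (Macintyre–Wilkie 1996, Thm. 1.1) if the real exponential field has the Schanuel property,
> then `Th(ℝ; +, *, -, 0, 1, exp, ≤)` is decidable — `SchanuelProperty ℝ → RealExpDecidable`.

That theorem is a whole theory (Wilkie's model completeness of `ℝ_exp` made effective,
Khovanskii's finiteness theorem, o-minimality of `ℝ_exp`, Newton approximation inside the models
of a recursive subtheory, and a Schanuel-based desingularisation of exponential varieties), far
beyond one file. Following the architecture of Macintyre–Wilkie's proof as reported in the
literature we hold, this file

1. **decomposes** it into its two halves, each vendored as a named fact, and proves the assembly;
2. **proves the logical skeleton** of the unconditional half in full generality: for any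
   structure `M`, a recursive subtheory `T₀ ⊆ Th(M)` which together with the existential theory
   `Th_∃(M)` axiomatizes `Th(M)` (this is what an *effectively model complete* axiom system
   provides, by Robinson's test) reduces the decidability of `Th(M)` to the computable
   axiomatizability of `Th_∃(M)` (given Janiczak's theorem), and conversely decidability of
   `Th(M)` makes `Th_∃(M)` recursive (given that existential sentences are recognizable).

## Contents

* `FirstOrder.Language.existentialTheory L M` — the existential theory `Th_∃(M)`: the existential
  sentences (Mathlib's `BoundedFormula.IsExistential`: a block of `∃` in front of a
  quantifier-free matrix) true in `M` (a definition, with API), and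
  `Literature.realExpExistentialTheory = Th_∃(ℝ_exp)`.
* `FirstOrder.Language.Theory.models_of_forall_iff_isExistential` (proved): if every sentence is
  `T₀`-equivalent to an existential sentence and `M ⊨ T₀`, then `T₀ ∪ Th_∃(M) ⊨ Th(M)`
  (the Robinson step); `…of_isModelComplete`: the same from model completeness of `T₀` and
  Robinson's test (the named fact `Theory.isModelComplete_iff_forall_exists_isExistential`, C7).
* `FirstOrder.Language.Theory.isComputablyAxiomatizable_completeTheory_of_union` (proved): if
  `T₀ ⊆ Th(M)` is recursive, `E ⊆ Th(M)` is computably axiomatizable and `T₀ ∪ E ⊨ Th(M)`, then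
  `Th(M)` is computably axiomatizable; with Janiczak's theorem (the named fact
  `Theory.isDecidable_of_isComplete_of_isComputablyAxiomatizable`, C9) `Th(M)` is decidable
  (`isDecidable_completeTheory_of_union`).
* `FirstOrder.Language.Theory.isRecursive_existentialTheory_of_isDecidable` (proved): if `Th(M)`
  is decidable and the set of Gödel numbers of existential sentences is computable, then
  `Th_∃(M)` is recursive.
* `Literature.ModelTheory.ExponentialFields.macintyreWilkie_realExpDecidable_iff_existential` (named fact, unconditional half):
  `Th(ℝ_exp)` is decidable **iff** `Th_∃(ℝ_exp)` is recursively axiomatizable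
  (Carl–Krapp 2021, p. 10, reporting Macintyre–Wilkie 1996: "Macintyre and Wilkie [16] proved
  that `Th(ℝ_exp)` is decidable if and only if its existential theory `Th_∃(ℝ_exp)` is
  recursively axiomatisable"; the direction `←` is the content — it rests on Wilkie's model
  completeness theorem in the constructive form given in Macintyre–Wilkie's paper, by which
  "the question of decidability of `T_exp` is reduced to the question of the decidability of the
  existential theory" (Wilkie 1997, as summarised in Zbl 0888.03022); Mariaule 2014, p. 2: "first
  we reduce the decidability of the full theory to the case of existential sentences. In the real
  case, it relies (among other things) on the effective model-completeness of the theory of the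
  reals in the language of ordered fields with the restricted exponential function").
* `Literature.ModelTheory.ExponentialFields.macintyreWilkie_existential_of_schanuelProperty` (named fact, conditional half): the real
  Schanuel conjecture implies that `Th_∃(ℝ_exp)` is recursively axiomatizable (Carl–Krapp 2021,
  p. 10: "Moreover, they showed that the latter holds if one assumes (SC)", with "(SC)" printed
  there as *Real Schanuel's Conjecture*: for `α₁, …, αₙ ∈ ℝ` linearly independent over `ℚ`,
  `trdeg_ℚ ℚ(α₁, …, αₙ, e^{α₁}, …, e^{αₙ}) ≥ n` — literally `Literature.SchanuelProperty ℝ`;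
  Berarducci–Servi 2004, p. 44: "Schanuel's conjecture (in the real case) … It is proved in [8]
  that Schanuel's conjecture implies the decidability of `T_exp`").
* `Literature.ModelTheory.ExponentialFields.macintyreWilkie_iff_mp` (proved): the direction `→` of the unconditional half —
  decidability of `Th(ℝ_exp)` makes `Th_∃(ℝ_exp)` computably axiomatizable;
  `Literature.ModelTheory.ExponentialFields.realExpDecidable_of_recursive_subtheory'` (proved): the direction `←` from a recursive
  `T₀ ⊆ Th(ℝ_exp)` with `T₀ ∪ Th_∃(ℝ_exp) ⊨ Th(ℝ_exp)`.
* `Literature.ModelTheory.ExponentialFields.macintyre_wilkie_of_parts` (proved): the two halves give `Literature.ModelTheory.ExponentialFields.macintyre_wilkie`;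
  `Literature.ModelTheory.ExponentialFields.realExpDecidable_of_recursive_subtheory`, `Literature.ModelTheory.ExponentialFields.macintyre_wilkie_of_recursive_subtheory`
  (proved): the specialisations of the skeleton to `ℝ_exp` — the form in which the argument is
  run in Macintyre–Wilkie's paper and in its later adaptations (Jones–Servi 2011, Prop. 3.1:
  "`T ∪ ∃Th(ℝ^α) ⊢ Th(ℝ^α)`" for a recursively axiomatized `T`, "the proof proceeds as in
  [MW96]"; Berarducci–Servi 2004, p. 45: "another candidate for a recursive axiomatization of
  `T_exp`, after the one considered in [8]").
* `Literature.ModelTheory.ExponentialFields.macintyreWilkie_recursiveSubtheory` (named fact — the unconditional half in the form in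
  which Macintyre–Wilkie's proof provides it): there is a recursive `T₀ ⊆ Th(ℝ_exp)` with
  `T₀ ∪ Th_∃(ℝ_exp) ⊨ Th(ℝ_exp)` (Jones–Servi 2011, §2 and Prop. 3.1, proceeding "as in [MW96]"
  and citing [MW96, p. 448]); from it the unconditional half follows outright
  (`Literature.ModelTheory.ExponentialFields.macintyreWilkie_realExpDecidable_iff_existential_of_recursiveSubtheory`, proved), and
  given it the conditional half is equivalent to `Literature.ModelTheory.ExponentialFields.macintyre_wilkie`
  (`Literature.ModelTheory.ExponentialFields.macintyreWilkie_existential_of_schanuelProperty_iff_macintyre_wilkie`, proved);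
  `Literature.ModelTheory.ExponentialFields.realExpDecidable_iff_exists_recursive_axiomatization` (proved): `Th(ℝ_exp)` is decidable
  iff it is axiomatized by a recursive set of true sentences.

## On the hypothesis of `macintyre_wilkie` (faithfulness check)

`Literature.ModelTheory.ExponentialFields.macintyre_wilkie` assumes the *real* Schanuel property `SchanuelProperty ℝ`, which is weaker
than Schanuel's conjecture for `ℂ` (`Literature.ModelTheory.ExponentialFields.schanuelProperty_real_of_complex_holds`), so the Lean
statement is formally *stronger* than "Schanuel's conjecture implies decidability" with the complex
conjecture (the form printed in Marcja–Toffalori 2003, Thm. 9.7.6 with Conjecture 9.7.4 over `ℂ`).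
Macintyre–Wilkie's argument only ever applies the conjecture to real tuples, and both
Berarducci–Servi 2004 (p. 44, "Schanuel's conjecture (in the real case)") and Carl–Krapp 2021
(p. 10, "Real Schanuel's Conjecture (SC)") attribute the real-hypothesis form to Macintyre–Wilkie
1996. The statement is therefore kept as vendored (not mis-stated).

## Source status

The primary source (Macintyre–Wilkie, in *Kreiseliana*, A K Peters 1996, pp. 441–467; no DOI) is
not held by the literature store at the time of writing (acquisition requested:
`isbn:9781568810614`, pp. 441–467); the internal theorem numbers of the two halves inside that
paper are therefore not quoted here — only Thm. 1.1 (the main theorem, locator carried by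
`Literature.ModelTheory.ExponentialFields.macintyre_wilkie`) — and each half carries, next to the cite of the original, the page of the
held secondary source whose printed restatement it formalises.

## What remains for `macintyre_wilkie_holds` (DAG)

`macintyre_wilkie ⇐ (A0) ∧ (B)` (`macintyre_wilkie_of_recursiveSubtheory`, proved), where
(A0) = `macintyreWilkie_recursiveSubtheory` (a recursive `T₀ ⊆ Th(ℝ_exp)` with
`T₀ ∪ Th_∃(ℝ_exp) ⊨ Th(ℝ_exp)`) and (B) = `macintyreWilkie_existential_of_schanuelProperty`.
The unconditional half (A) = `macintyreWilkie_realExpDecidable_iff_existential` is *proved* from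
(A0) (`…_of_recursiveSubtheory`): its direction `(A)←` by
`realExpDecidable_of_recursive_subtheory'` (Janiczak's theorem being proved in
`DecidableTheoryProofs.lean` on top of the decidability of the set of Gödel numbers of sentences,
`ProofTheory/SentenceCodes.lean`), its direction `(A)→` outright (`macintyreWilkie_iff_mp`, via
the decidability of the set of Gödel numbers of *existential* sentences,
`ProofTheory/ExistentialCodes.lean`); Robinson's test, by which a recursive *model complete*
subtheory witnesses (A0), is proved in `ExistentialPreservation.lean`. Given (A0), (B) is
equivalent to `macintyre_wilkie` itself
(`macintyreWilkie_existential_of_schanuelProperty_iff_macintyre_wilkie`). Open inputs, both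
internal to Macintyre–Wilkie's paper and resting on the analysis of `ℝ_exp`: (A0) — the
recursive subtheory `T₀` (effective model completeness of restricted `exp` à la Wilkie,
Khovanskii bounds, Ressayre's axioms) — and (B) (Newton approximation in models of `T₀`,
Wilkie's desingularisation Thm. 5.1, Schanuel's conjecture).

A second, elementary route to the same theorem is recorded in `LastRootConjecture.lean`:
Macintyre–Wilkie's unconditional equivalence `RealExpDecidable ↔ LastRootConjecture` (named fact
`macintyreWilkie_realExpDecidable_iff_lastRootConjecture`, the *Last Root* / *Weak Schanuel*
conjecture being a computable bound on the non-singular zeros of `n × n` exponential systems over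
`ℤ`), so that `macintyre_wilkie ↔ (SchanuelProperty ℝ → LastRootConjecture)` given it; the
direction `→` of that equivalence is proved from Wilkie's o-minimality theorem in
`LastRootConjectureOfDecidable.lean` (`lastRootConjecture_of_realExpDecidable`, on top of
`LastRootConjectureProofs.lean`), its direction `←` being again the analytic core of the paper.

## Mathlib / Literature search

Mathlib has `BoundedFormula.IsExistential`, `IsUniversal`, `IsQF`, `IsQF.relabel`,
`Language.completeTheory`, `Theory.Model`, `Theory.Iff`, `models_of_models_theory`,
`IsMaximal.mem_of_models`, `ComputablePred`, `ComputablePred.computable_iff`, `Primrec.or/and`;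
the Gödel numbering, `Theory.IsDecidable`, `Theory.IsRecursive`,
`Theory.IsComputablyAxiomatizable`, Janiczak's theorem (named fact) are Literature
(`DecidableTheory.lean`, C9), Robinson's test (named fact) and `Theory.IsModelComplete` are
Literature (`ModelTheoryPreds.lean`, C7), as are `RealExpDecidable`, `SchanuelProperty`,
`macintyre_wilkie`. Nothing on existential theories of structures or on Macintyre–Wilkie's
reduction exists in either (`lean search 'existentialTheory|xistential.*realExp'` is empty).

## Design

The generic material is placed, like the rest of this topic (C7, C9), as deliberate dot-notation
extensions in Mathlib's namespaces `FirstOrder.Language` (`existentialTheory` and its API),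
`FirstOrder.Language.BoundedFormula` (`IsExistential.relabel`) and `FirstOrder.Language.Theory`
(the skeleton theorems); the two closure lemmas for `ComputablePred` and everything about `ℝ_exp`
live in `namespace Literature`.

## References

* A. Macintyre, A. J. Wilkie, *On the decidability of the real exponential field*, in:
  Kreiseliana: About and Around Georg Kreisel (P. Odifreddi, ed.), A K Peters (1996), 441–467
  (Zbl 0896.03012), Thm. 1.1.
* A. J. Wilkie, *Schanuel's conjecture and the decidability of the real exponential field*, in:
  Algebraic Model Theory (Toronto 1996), NATO ASI Ser. C 496, Kluwer (1997), 223–230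
  (Zbl 0888.03022).
* M. Carl, L. S. Krapp, *Models of true arithmetic are integer parts of models of real
  exponentiation*, J. Log. Anal. 13:3 (2021), 1–21, p. 10 (§4.2).
* A. Berarducci, T. Servi, *An effective version of Wilkie's theorem of the complement and some
  effective o-minimality results*, Ann. Pure Appl. Logic 125 (2004), 43–74, pp. 44–45.
* G. O. Jones, T. Servi, *On the decidability of the real field with a generic power function*,
  J. Symb. Log. 76 (2011), 1418–1428, §3, Prop. 3.1.
* N. Mariaule, *p-adic exponential ring, p-adic Schanuel's conjecture and decidability*,
  arXiv:1408.0900 (2014), p. 2.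
* R. Bianconi, *Uniform model completeness for the real field with the Weierstrass ℘
  function*, arXiv:1410.7191 (2014), p. 9.
* A. Marcja, C. Toffalori, *A Guide to Classical and Modern Model Theory*, Kluwer (2003), §9.7,
  Conjecture 9.7.4 and Thm. 9.7.6.
* D. Marker, *Model Theory: An Introduction*, Springer GTM 217 (2002), §2.2 (Lemma 2.2.8),
  Prop. 3.1.12.
* H. B. Enderton, *A Mathematical Introduction to Logic*, 2nd ed. (2001), §3.4–3.5.
-/

universe u v w

open FirstOrder

/-! ### Two closure properties of computable predicates -/

namespace Literature.ModelTheory.ExponentialFields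

/-- Computable predicates are closed under disjunction (decide both and take `or`;
Mathlib `Primrec.or`, `ComputablePred.computable_iff`). [folklore] -/
theorem computablePred_or {α : Type*} [Primcodable α] {p q : α → Prop} (hp : ComputablePred p)
    (hq : ComputablePred q) : ComputablePred fun a => p a ∨ q a := by
  obtain ⟨f, hf, rfl⟩ := ComputablePred.computable_iff.1 hp
  obtain ⟨g, hg, rfl⟩ := ComputablePred.computable_iff.1 hq
  refine ComputablePred.computable_iff.2 ⟨fun a => f a || g a, ?_, ?_⟩
  · exact Primrec.or.to_comp.comp hf hg
  · funext a
    simp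

/-- Computable predicates are closed under conjunction (decide both and take `and`;
Mathlib `Primrec.and`, `ComputablePred.computable_iff`). [folklore] -/
theorem computablePred_and {α : Type*} [Primcodable α] {p q : α → Prop} (hp : ComputablePred p)
    (hq : ComputablePred q) : ComputablePred fun a => p a ∧ q a := by
  obtain ⟨f, hf, rfl⟩ := ComputablePred.computable_iff.1 hp
  obtain ⟨g, hg, rfl⟩ := ComputablePred.computable_iff.1 hq
  refine ComputablePred.computable_iff.2 ⟨fun a => f a && g a, ?_, ?_⟩
  · exact Primrec.and.to_comp.comp hf hg
  · funext a
    simp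

end Literature.ModelTheory.ExponentialFields

namespace FirstOrder.Language

variable {L : Language.{u, v}}

/-! ### Existential sentences are stable under relabelling -/

/-- Relabelling the free variables of an existential formula gives an existential formula
(companion to Mathlib's `IsQF.relabel`, `IsPrenex.relabel`). [folklore] -/
theorem BoundedFormula.IsExistential.relabel {α β : Type*} {n m : ℕ} {φ : L.BoundedFormula α m}
    (h : φ.IsExistential) (g : α → β ⊕ Fin n) : (φ.relabel g).IsExistential := by
  induction h with
  | of_isQF hqf => exact IsExistential.of_isQF (hqf.relabel g)
  | ex _ ih =>
    rw [BoundedFormula.relabel_ex]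
    exact ih.ex

/-! ### The existential theory of a structure -/

section ExistentialTheory

variable (L) (M : Type w) [L.Structure M]

/-- The *existential theory* `Th_∃(M)` of an `L`-structure `M`: the set of existential sentences —
in Mathlib's sense `BoundedFormula.IsExistential`, i.e. prenex sentences `∃ x₁ … ∃ xₙ ψ` with `ψ`
quantifier-free — that are true in `M` (Carl–Krapp 2021, p. 10: "its existential theory
`Th_∃(ℝ_exp)`"; Wilkie 1997: "the existential theory, `𝓔_exp`, of `ℝ_exp`"; Hodges, *Model
Theory*, §6.5 writes `Th_∃`). A definition. [cite: CarlKrapp2021, p. 10] -/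
def existentialTheory : L.Theory :=
  {φ | BoundedFormula.IsExistential φ ∧ M ⊨ φ}

variable {L M}

/-- Membership in `Th_∃(M)` (by definition): an existential sentence true in `M`. [folklore] -/
theorem mem_existentialTheory_iff {φ : L.Sentence} :
    φ ∈ L.existentialTheory M ↔ BoundedFormula.IsExistential φ ∧ M ⊨ φ :=
  Iff.rfl

/-- `Th_∃(M) ⊆ Th(M)`. [folklore] -/
theorem existentialTheory_subset_completeTheory : L.existentialTheory M ⊆ L.completeTheory M :=
  fun _ h => mem_completeTheory.2 h.2

variable (L M) in
/-- `M` is a model of its existential theory (tautologically). [folklore] -/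
instance model_existentialTheory : M ⊨ L.existentialTheory M :=
  ⟨fun _ h => h.2⟩

/-- A sentence of `Th_∃(M)` is existential. [folklore] -/
theorem isExistential_of_mem_existentialTheory {φ : L.Sentence}
    (h : φ ∈ L.existentialTheory M) : BoundedFormula.IsExistential φ :=
  h.1

/-- A sentence of `Th_∃(M)` is true in `M`. [folklore] -/
theorem realize_of_mem_existentialTheory {φ : L.Sentence} (h : φ ∈ L.existentialTheory M) :
    M ⊨ φ :=
  h.2

/-- Quantifier-free sentences true in `M` belong to `Th_∃(M)` (an existential block may be
empty: `BoundedFormula.IsExistential.of_isQF`). [folklore] -/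
theorem mem_existentialTheory_of_isQF {φ : L.Sentence} (hqf : BoundedFormula.IsQF φ)
    (h : M ⊨ φ) : φ ∈ L.existentialTheory M :=
  ⟨BoundedFormula.IsExistential.of_isQF hqf, h⟩

/-- `Th_∃(M) = Th(M) ∩ {existential sentences}`. [folklore] -/
theorem existentialTheory_eq_sep :
    L.existentialTheory M = {φ ∈ L.completeTheory M | BoundedFormula.IsExistential φ} := by
  ext φ
  simp only [mem_existentialTheory_iff, Set.mem_setOf_eq, mem_completeTheory]
  exact and_comm

end ExistentialTheory

namespace Theory

/-! ### Sentences versus formulas in no free variables -/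

/-- Two sentences with the same truth value in every model of `T` are `T`-equivalent
(converse of Mathlib's `Theory.Iff.models_sentence_iff`). [folklore] -/
theorem iff_of_forall_modelType {T : L.Theory} {φ ψ : L.Sentence}
    (h : ∀ M : ModelType.{u, v, max u v} T, M ⊨ φ ↔ M ⊨ ψ) : φ ⇔[T] ψ := by
  intro M v xs
  rw [BoundedFormula.realize_iff]
  obtain rfl : v = default := Subsingleton.elim _ _
  obtain rfl : xs = default := Subsingleton.elim _ _
  exact h M

/-- If every formula in no free variables is `T`-equivalent to an existential one, then every
*sentence* is `T`-equivalent to an existential sentence (transport along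
`Formula.relabel` between `L.Sentence = L.Formula Empty` and `L.Formula (Fin 0)`). [folklore] -/
theorem forall_sentence_iff_isExistential_of_formula {T : L.Theory}
    (h : ∀ φ : L.Formula (Fin 0), ∃ ψ : L.Formula (Fin 0), ψ.IsExistential ∧ (φ ⇔[T] ψ)) :
    ∀ φ : L.Sentence, ∃ ψ : L.Sentence, ψ.IsExistential ∧ (φ ⇔[T] ψ) := by
  intro φ
  obtain ⟨ψ, hψ, hiff⟩ := h (Formula.relabel (Empty.elim : Empty → Fin 0) φ)
  refine ⟨Formula.relabel (fun i : Fin 0 => i.elim0) ψ, hψ.relabel _, ?_⟩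
  refine iff_of_forall_modelType fun M => ?_
  have h1 := hiff.realize_iff (M := M) (v := (default : Fin 0 → M))
  rw [Formula.realize_relabel] at h1
  have h2 : (Formula.relabel (fun i : Fin 0 => i.elim0) ψ).Realize (default : Empty → M) ↔
      ψ.Realize (default : Fin 0 → M) := by
    rw [Formula.realize_relabel]
    exact iff_of_eq (congrArg _ (Subsingleton.elim _ _))
  have h3 : (default : Fin 0 → M) ∘ (Empty.elim : Empty → Fin 0) = (default : Empty → M) :=
    Subsingleton.elim _ _
  rw [h3] at h1
  exact h1.trans h2.symm

/-! ### The Robinson step: `T₀ ∪ Th_∃(M) ⊨ Th(M)` -/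

section Robinson

variable {T : L.Theory} {M : Type w} [L.Structure M] [Nonempty M] [M ⊨ T]

/-- **The Robinson step.** If every sentence is `T`-equivalent to an existential sentence and
`M ⊨ T`, then `T` together with the existential theory of `M` axiomatizes the complete theory of
`M`: `T ∪ Th_∃(M) ⊨ φ` for every `φ` true in `M`. (For `φ` true in `M`, its existential
`T`-equivalent `ψ` is true in `M`, hence lies in `Th_∃(M)`; every model of `T ∪ Th_∃(M)`
satisfies `ψ` and `φ ↔ ψ`.) This is the use of model completeness in Macintyre–Wilkie's
reduction (Jones–Servi 2011, proof of Prop. 3.1: "By model completeness of `T_res`, we have that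
`Th(ℝ^α_res)` is axiomatized by `T_res` and the existential fragment"); as pure logic it is
folklore (Marker 2002, Prop. 3.1.12; Hodges, *Model Theory*, Thm. 8.3.1). [folklore] -/
theorem models_of_forall_iff_isExistential
    (h : ∀ φ : L.Sentence, ∃ ψ : L.Sentence, ψ.IsExistential ∧ (φ ⇔[T] ψ))
    {φ : L.Sentence} (hφ : M ⊨ φ) : (T ∪ L.existentialTheory M) ⊨ᵇ φ := by
  obtain ⟨ψ, hψ, hiff⟩ := h φ
  have hMψ : M ⊨ ψ := hiff.models_sentence_iff.1 hφ
  have hψmem : ψ ∈ T ∪ L.existentialTheory M := Set.mem_union_right _ ⟨hψ, hMψ⟩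
  refine models_sentence_iff.2 fun N => ?_
  have hNT : (N : Type _) ⊨ T := Theory.Model.mono N.is_model Set.subset_union_left
  have hNψ : (N : Type _) ⊨ ψ := Theory.realize_sentence_of_mem (T ∪ L.existentialTheory M) hψmem
  exact hiff.models_sentence_iff.2 hNψ

/-- The Robinson step, membership form: `T ∪ Th_∃(M) ⊨ Th(M)`. [folklore] -/
theorem models_of_mem_completeTheory_of_forall_iff_isExistential
    (h : ∀ φ : L.Sentence, ∃ ψ : L.Sentence, ψ.IsExistential ∧ (φ ⇔[T] ψ))
    {φ : L.Sentence} (hφ : φ ∈ L.completeTheory M) : (T ∪ L.existentialTheory M) ⊨ᵇ φ :=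
  models_of_forall_iff_isExistential h (mem_completeTheory.1 hφ)

/-- The Robinson step from **model completeness**: if `T` is model complete and `M ⊨ T`, then
`T ∪ Th_∃(M) ⊨ Th(M)` — given Robinson's test in syntactic form (every formula is `T`-equivalent
to an existential one; the named fact `Theory.isModelComplete_iff_forall_exists_isExistential`
of `ModelTheoryPreds.lean`, Marker 2002, Prop. 3.1.12). [cite: Marker2002, Prop. 3.1.12] -/
theorem models_of_isModelComplete
    (hR : isModelComplete_iff_forall_exists_isExistential (T := T)) (hT : T.IsModelComplete)
    {φ : L.Sentence} (hφ : M ⊨ φ) : (T ∪ L.existentialTheory M) ⊨ᵇ φ :=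
  models_of_forall_iff_isExistential (forall_sentence_iff_isExistential_of_formula (hR.1 hT 0)) hφ


/-- The Robinson step from **model completeness**, Robinson's test being proved
(`isModelComplete_iff_forall_exists_isExistential_holds`, `ExistentialPreservation.lean`): if `T`
is model complete and `M ⊨ T`, then `T ∪ Th_∃(M) ⊨ Th(M)`. [cite: Marker2002, Prop. 3.1.12] -/
theorem models_of_isModelComplete' (hT : T.IsModelComplete) {φ : L.Sentence} (hφ : M ⊨ φ) :
    (T ∪ L.existentialTheory M) ⊨ᵇ φ :=
  models_of_isModelComplete isModelComplete_iff_forall_exists_isExistential_holds hT hφ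

end Robinson

/-- Consequence is monotone in the theory. [folklore] -/
theorem models_sentence_mono {T T' : L.Theory} (hs : T ⊆ T') {φ : L.Sentence} (h : T ⊨ᵇ φ) :
    T' ⊨ᵇ φ :=
  models_of_models_theory (fun _ hψ => models_sentence_of_mem (hs hψ)) h

/-! ### Recursive axiomatizations modulo the existential theory -/

section Axiomatization

variable [Encodable (Σ i, L.Functions i)] [Encodable (Σ i, L.Relations i)]

/-- The union of two recursive sets of sentences is recursive. [folklore] -/
theorem IsRecursive.union {T T' : L.Theory} (h : T.IsRecursive) (h' : T'.IsRecursive) :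
    (T ∪ T').IsRecursive := by
  refine (Literature.ModelTheory.ExponentialFields.computablePred_or h h').of_eq fun n => ?_
  constructor
  · rintro (⟨φ, hφ, hn⟩ | ⟨φ, hφ, hn⟩)
    exacts [⟨φ, Set.mem_union_left _ hφ, hn⟩, ⟨φ, Set.mem_union_right _ hφ, hn⟩]
  · rintro ⟨φ, hφ | hφ, hn⟩
    exacts [Or.inl ⟨φ, hφ, hn⟩, Or.inr ⟨φ, hφ, hn⟩]

variable {M : Type w} [L.Structure M] [Nonempty M]

/-- **Recursive axiomatization modulo a computably axiomatizable fragment.** If `T₀ ⊆ Th(M)` is a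
recursive set of sentences, `E ⊆ Th(M)` is computably axiomatizable, and `T₀ ∪ E ⊨ Th(M)`, then
`Th(M)` is computably axiomatizable — by `T₀ ∪ A` for any recursive `A` with the same
consequences as `E`. With `E = Th_∃(M)` this is the passage "`Th(ℝ_exp)` is decidable if its
existential theory is recursively axiomatizable" of Macintyre–Wilkie's reduction, granted a
recursive `T₀` with `T₀ ∪ Th_∃ ⊨ Th` (Jones–Servi 2011, §3: "in order to prove the decidability
of `Th(ℝ^α)`, it is enough to recursively axiomatize its existential fragment"). [folklore] -/
theorem isComputablyAxiomatizable_completeTheory_of_union {T₀ E : L.Theory}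
    (hT₀ : T₀ ⊆ L.completeTheory M) (hrec : T₀.IsRecursive) (hE : E ⊆ L.completeTheory M)
    (hEax : E.IsComputablyAxiomatizable)
    (hgen : ∀ φ ∈ L.completeTheory M, (T₀ ∪ E) ⊨ᵇ φ) :
    (L.completeTheory M).IsComputablyAxiomatizable := by
  obtain ⟨A, hA, hAE⟩ := hEax
  refine ⟨T₀ ∪ A, hrec.union hA, fun φ => ⟨fun h => ?_, fun h => ?_⟩⟩
  · refine models_of_models_theory (fun ψ hψ => ?_) h
    rcases hψ with hψ | hψ
    · exact models_sentence_of_mem (hT₀ hψ)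
    · exact models_of_models_theory (fun χ hχ => models_sentence_of_mem (hE hχ))
        ((hAE ψ).1 (models_sentence_of_mem hψ))
  · have hmem : φ ∈ L.completeTheory M := (completeTheory.isMaximal L M).mem_of_models h
    refine models_of_models_theory (fun ψ hψ => ?_) (hgen φ hmem)
    rcases hψ with hψ | hψ
    · exact models_sentence_of_mem (Set.mem_union_left _ hψ)
    · exact models_sentence_mono Set.subset_union_right ((hAE ψ).2 (models_sentence_of_mem hψ))

/-- **Decidability from a recursive axiomatization modulo a computably axiomatizable fragment**:
under the hypotheses of `isComputablyAxiomatizable_completeTheory_of_union`, and granted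
Janiczak's theorem (a complete computably axiomatizable theory in a recursively presented
language is decidable: the named fact `Theory.isDecidable_of_isComplete_of_isComputablyAxiomatizable`
of `DecidableTheory.lean`; Marker 2002, Lemma 2.2.8), the complete theory `Th(M)` is decidable. [cite: Marker2002, Lemma 2.2.8] -/
theorem isDecidable_completeTheory_of_union
    (hJ : isDecidable_of_isComplete_of_isComputablyAxiomatizable (L := L))
    (hL : L.IsRecursivelyPresented) {T₀ E : L.Theory}
    (hT₀ : T₀ ⊆ L.completeTheory M) (hrec : T₀.IsRecursive) (hE : E ⊆ L.completeTheory M)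
    (hEax : E.IsComputablyAxiomatizable)
    (hgen : ∀ φ ∈ L.completeTheory M, (T₀ ∪ E) ⊨ᵇ φ) :
    (L.completeTheory M).IsDecidable :=
  hJ hL (completeTheory.isComplete L M)
    (isComputablyAxiomatizable_completeTheory_of_union hT₀ hrec hE hEax hgen)

/-- **The converse bookkeeping.** If `Th(M)` is decidable and the set of Gödel numbers of
existential sentences is computable, then the existential theory `Th_∃(M)` is a recursive set of
sentences (`Th_∃(M) = Th(M) ∩ {existential sentences}` and Gödel numbering is injective). The
recognizability hypothesis is a property of the coding of syntax alone (Enderton 2001, §3.4). [folklore] -/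
theorem isRecursive_existentialTheory_of_isDecidable
    (hEx : ComputablePred fun n : ℕ =>
      ∃ φ : L.Sentence, BoundedFormula.IsExistential φ ∧ φ.godelNumber = n)
    (hdec : (L.completeTheory M).IsDecidable) : (L.existentialTheory M).IsRecursive := by
  have hrec : (L.completeTheory M).IsRecursive :=
    (isDecidable_iff_isRecursive_of_isMaximal (completeTheory.isMaximal L M)).1 hdec
  refine (Literature.ModelTheory.ExponentialFields.computablePred_and hEx hrec).of_eq fun n => ⟨?_, ?_⟩
  · rintro ⟨⟨φ, hφ, hn⟩, ⟨ψ, hψ, hn'⟩⟩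
    obtain rfl : φ = ψ := Sentence.godelNumber_injective (hn.trans hn'.symm)
    exact ⟨φ, ⟨hφ, mem_completeTheory.1 hψ⟩, hn⟩
  · rintro ⟨φ, ⟨hφ, hMφ⟩, hn⟩
    exact ⟨⟨φ, hφ, hn⟩, ⟨φ, mem_completeTheory.2 hMφ, hn⟩⟩

end Axiomatization

/-! ### Recursively enumerable versus computably axiomatizable existential theories -/

section REAxioms

variable [Encodable (Σ i, L.Functions i)] [Encodable (Σ i, L.Relations i)]

/-- The conjunction of a computable and an r.e. predicate is r.e. [folklore] -/
theorem _root_.REPred.computable_and {p q : ℕ → Prop} (hp : ComputablePred p) (hq : REPred q) :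
    REPred fun n => p n ∧ q n := by
  obtain ⟨f, hf, rfl⟩ := ComputablePred.computable_iff.1 hp
  have h : Partrec fun n => cond (f n) (Part.assert (q n) fun _ => Part.some ()) Part.none :=
    Partrec.cond hf hq Partrec.none
  refine h.of_eq fun n => ?_
  by_cases hn : f n = true
  · simp only [hn, cond_true]
    exact Part.ext' ⟨fun hd => ⟨⟨hn, hd.1⟩, trivial⟩, fun hd => ⟨hd.1.2, trivial⟩⟩
      fun _ _ => Subsingleton.elim _ _
  · simp only [Bool.not_eq_true] at hn
    simp only [hn, cond_false]
    refine Part.ext' ⟨fun hd => hd.elim, fun hd => ?_⟩ fun h₁ _ => h₁.elim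
    have h' : f n = true := hd.1.1
    rw [hn] at h'
    exact Bool.false_ne_true h'

variable {M : Type w} [L.Structure M] [Nonempty M]

/-- For the existential theory of a structure, computable axiomatizability gives an r.e. set of
axioms — indeed `Th_∃(M)` itself is then r.e.: `Th_∃(M) = {φ existential | A ⊨ φ}` for any
axiomatization `A`, and the consequences of a recursive `A` are r.e. (enumerability theorem,
`IsComputablyAxiomatizable.isRE_holds`) while existential sentences are recognizable
(`ExistentialCodes.lean`). [folklore] -/
theorem isREAxioms_existentialTheory_of_isComputablyAxiomatizable (hL : L.IsRecursivelyPresented)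
    (h : (L.existentialTheory M).IsComputablyAxiomatizable) : (L.existentialTheory M).IsREAxioms := by
  obtain ⟨A, hA, hAE⟩ := h
  have hre : A.IsRE := IsComputablyAxiomatizable.isRE_holds hL hA.isComputablyAxiomatizable
  have hex := Literature.ModelTheory.ProofTheory.PreFOL.computablePred_exists_isExistential_godelNumber_eq (L := L)
    hL.computable_arityF hL.computable_arityR
  refine (REPred.computable_and hex hre).of_eq fun n => ⟨?_, ?_⟩
  · rintro ⟨⟨φ, hφ, hn⟩, ⟨ψ, hψ, hn'⟩⟩
    obtain rfl : φ = ψ := Sentence.godelNumber_injective (hn.trans hn'.symm)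
    have hM : M ⊨ φ := ((hAE φ).1 hψ).realize_sentence M
    exact ⟨φ, ⟨hφ, hM⟩, hn⟩
  · rintro ⟨φ, hφ, hn⟩
    exact ⟨⟨φ, hφ.1, hn⟩, ⟨φ, (hAE φ).2 (models_sentence_of_mem hφ), hn⟩⟩

/-- **`Th_∃(M)` is computably axiomatizable iff it is an r.e. set of sentences** (in a recursively
presented language; `←` is Craig's theorem, `CraigAxiomatization.lean`). So the two readings of
"the existential theory is recursively axiomatizable / recursively enumerable" found in the
literature on Macintyre–Wilkie's theorem agree. [folklore] -/
theorem isComputablyAxiomatizable_existentialTheory_iff_isREAxioms (hL : L.IsRecursivelyPresented) :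
    (L.existentialTheory M).IsComputablyAxiomatizable ↔ (L.existentialTheory M).IsREAxioms :=
  ⟨isREAxioms_existentialTheory_of_isComputablyAxiomatizable hL,
    fun h => h.isComputablyAxiomatizable hL⟩

end REAxioms

end Theory

end FirstOrder.Language

/-! ### The real exponential field -/

noncomputable section

namespace Literature.ModelTheory.ExponentialFields

/-! #### The existential theory of `ℝ_exp` -/

/-- The *existential theory* `Th_∃(ℝ_exp)` of the real exponential field: the existential
sentences of `Language.orderedExpRing = (+, *, -, 0, 1, exp, ≤)` true in `ℝ`
(`Language.existentialTheory` specialised; Carl–Krapp 2021, p. 10: "its existential theory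
`Th_∃(ℝ_exp)`"; Wilkie 1997: "the existential theory, `𝓔_exp`, of `ℝ_exp`"). [cite: CarlKrapp2021, p. 10] -/
def realExpExistentialTheory : Language.orderedExpRing.Theory :=
  Language.orderedExpRing.existentialTheory ℝ

/-- `realExpExistentialTheory` is `Th_∃(ℝ_exp)` (by definition). [folklore] -/
theorem realExpExistentialTheory_eq :
    realExpExistentialTheory = Language.orderedExpRing.existentialTheory ℝ :=
  rfl

/-- Membership in `Th_∃(ℝ_exp)` (by definition): an existential sentence true in `ℝ_exp`. [folklore] -/
theorem mem_realExpExistentialTheory_iff {φ : Language.orderedExpRing.Sentence} :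
    φ ∈ realExpExistentialTheory ↔ Language.BoundedFormula.IsExistential φ ∧ ℝ ⊨ φ :=
  Iff.rfl

/-- `Th_∃(ℝ_exp) ⊆ Th(ℝ_exp) = realExpTheory`. [folklore] -/
theorem realExpExistentialTheory_subset_realExpTheory :
    realExpExistentialTheory ⊆ realExpTheory :=
  Language.existentialTheory_subset_completeTheory

/-- `ℝ_exp` is a model of its existential theory (tautologically). [folklore] -/
instance Real.model_realExpExistentialTheory : ℝ ⊨ realExpExistentialTheory :=
  Language.model_existentialTheory _ _

/-- Quantifier-free sentences true in `ℝ_exp` belong to `Th_∃(ℝ_exp)`. [folklore] -/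
theorem mem_realExpExistentialTheory_of_isQF {φ : Language.orderedExpRing.Sentence}
    (hqf : Language.BoundedFormula.IsQF φ) (h : ℝ ⊨ φ) : φ ∈ realExpExistentialTheory :=
  Language.mem_existentialTheory_of_isQF hqf h

/-! #### The two halves of Macintyre–Wilkie's theorem (named facts) -/

/-- **Macintyre–Wilkie, unconditional half** (Macintyre–Wilkie 1996; as restated by Carl–Krapp
2021, p. 10: "Macintyre and Wilkie [16] proved that `Th(ℝ_exp)` is decidable if and only if its
existential theory `Th_∃(ℝ_exp)` is recursively axiomatisable"). With the conventions of
`DecidableTheory.lean` (C9): the complete theory `realExpTheory = Th(ℝ; +, *, -, 0, 1, exp, ≤)` is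
decidable (`RealExpDecidable`, the set of Gödel numbers of its consequences is computable) if and
only if the existential theory `realExpExistentialTheory = Th_∃(ℝ_exp)` is computably
axiomatizable (`Theory.IsComputablyAxiomatizable`: some recursive set of sentences has exactly the
same consequences). The direction `→` is elementary bookkeeping
(`Theory.isRecursive_existentialTheory_of_isDecidable`); the direction `←` is the substance — it
is Wilkie's model completeness of `ℝ_exp` in the constructive form established in
Macintyre–Wilkie's paper, which "reduce[s] the decidability of the full theory to the case of
existential sentences" (Mariaule 2014, p. 2; Wilkie 1997, Zbl 0888.03022), i.e. supplies the
recursive `T₀` of `realExpDecidable_of_recursive_subtheory`. Our language has `≤` where the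
sources write `<`; the two are quantifier-free interdefinable, which changes neither side of the
equivalence. A named fact (`def … : Prop`), not yet proved here. [cite: MacintyreWilkieKreiseliana1996] [cite: CarlKrapp2021, p. 10] -/
def macintyreWilkie_realExpDecidable_iff_existential : Prop :=
  RealExpDecidable ↔ realExpExistentialTheory.IsComputablyAxiomatizable

/-- **Macintyre–Wilkie, conditional half** (Macintyre–Wilkie 1996; as restated by Carl–Krapp 2021,
p. 10, immediately after the equivalence `macintyreWilkie_realExpDecidable_iff_existential`:
"Moreover, they showed that the latter holds if one assumes (SC)", where "(SC)" is printed as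
*Real Schanuel's Conjecture*: "Let `α₁, …, αₙ ∈ ℝ` be linearly independent over `ℚ`. Then the
transcendence degree of `ℚ(α₁, …, αₙ, e^{α₁}, …, e^{αₙ})` over `ℚ` is at least `n`" — which is
`SchanuelProperty ℝ`; likewise Berarducci–Servi 2004, p. 44: "Schanuel's conjecture (in the real
case) …"). If the real exponential field has the Schanuel property, then the existential theory
`Th_∃(ℝ_exp)` is computably axiomatizable. (In Macintyre–Wilkie's proof the Schanuel property
serves to show that every existential sentence true in `ℝ_exp` is a consequence of their
recursive subtheory: truth is certified at non-singular zeros of systems of exponential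
polynomials by Newton approximation, and Schanuel's conjecture desingularises.)
A named fact (`def … : Prop`), not yet proved here. [cite: MacintyreWilkieKreiseliana1996] [cite: CarlKrapp2021, p. 10] -/
def macintyreWilkie_existential_of_schanuelProperty : Prop :=
  SchanuelProperty ℝ → realExpExistentialTheory.IsComputablyAxiomatizable

/-! #### Assembly -/

/-- **Assembly of periods.S27.** The two halves of Macintyre–Wilkie's argument — the unconditional
reduction of `Th(ℝ_exp)` to its existential theory and the Schanuel-conditional computable
axiomatizability of the latter — give Macintyre–Wilkie's Theorem 1.1 in the vendored form
`Literature.macintyre_wilkie : SchanuelProperty ℝ → RealExpDecidable`. [cite: MacintyreWilkieKreiseliana1996, Thm. 1.1] -/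
theorem macintyre_wilkie_of_parts (hA : macintyreWilkie_realExpDecidable_iff_existential)
    (hB : macintyreWilkie_existential_of_schanuelProperty) : macintyre_wilkie :=
  fun h => hA.2 (hB h)

/-- A recursive set of sentences is computably axiomatizable (by itself); in particular, if
`Th_∃(ℝ_exp)` is a recursive set of sentences then it is computably axiomatizable
(`Theory.IsRecursive.isComputablyAxiomatizable` of C9, specialised). [folklore] -/
theorem realExpExistentialTheory.isComputablyAxiomatizable_of_isRecursive
    (h : realExpExistentialTheory.IsRecursive) :
    realExpExistentialTheory.IsComputablyAxiomatizable :=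
  h.isComputablyAxiomatizable

/-- Variant of the assembly: the unconditional half together with any proof that the Schanuel
property makes `Th_∃(ℝ_exp)` a *recursive* set of sentences (a formally stronger intermediate
conclusion than computable axiomatizability) also yields `Literature.ModelTheory.ExponentialFields.macintyre_wilkie`. [folklore] -/
theorem macintyre_wilkie_of_iff_of_isRecursive
    (hA : macintyreWilkie_realExpDecidable_iff_existential)
    (hB : SchanuelProperty ℝ → realExpExistentialTheory.IsRecursive) : macintyre_wilkie :=
  fun h => hA.2 (hB h).isComputablyAxiomatizable

/-- Conversely to the assembly, Macintyre–Wilkie's theorem together with the unconditional half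
shows that under the real Schanuel property the existential theory is computably axiomatizable;
i.e. given the unconditional half, `macintyre_wilkie` and the conditional half are equivalent
ways of stating the Schanuel-conditional result. [folklore] -/
theorem macintyreWilkie_existential_of_schanuelProperty_of_macintyre_wilkie
    (hA : macintyreWilkie_realExpDecidable_iff_existential) (hMW : macintyre_wilkie) :
    macintyreWilkie_existential_of_schanuelProperty :=
  fun h => hA.1 (hMW h)

/-! #### The skeleton of the unconditional half, specialised to `ℝ_exp` -/

/-- The Robinson step for `ℝ_exp`: a subtheory `T₀ ⊆ Th(ℝ_exp)` modulo which every sentence is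
equivalent to an existential sentence axiomatizes `Th(ℝ_exp)` together with `Th_∃(ℝ_exp)`. [folklore] -/
theorem realExpTheory_models_of_forall_iff_isExistential {T₀ : Language.orderedExpRing.Theory}
    (hT₀ : T₀ ⊆ realExpTheory)
    (h : ∀ φ : Language.orderedExpRing.Sentence, ∃ ψ : Language.orderedExpRing.Sentence,
      ψ.IsExistential ∧ (φ ⇔[T₀] ψ)) :
    ∀ φ ∈ realExpTheory, (T₀ ∪ realExpExistentialTheory) ⊨ᵇ φ := by
  have : ℝ ⊨ T₀ := Language.Theory.Model.mono (inferInstance : ℝ ⊨ realExpTheory) hT₀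
  exact fun φ hφ => Language.Theory.models_of_mem_completeTheory_of_forall_iff_isExistential h hφ

/-- The Robinson step for `ℝ_exp` from model completeness of the subtheory (granted Robinson's
test, C7). Wilkie's theorem (`Literature.ModelTheory.ExponentialFields.wilkie_isModelComplete`) is the case `T₀ = Th(ℝ_exp)`; the
point of Macintyre–Wilkie's effective version is a *recursive* such `T₀`. [cite: Marker2002, Prop. 3.1.12] -/
theorem realExpTheory_models_of_isModelComplete {T₀ : Language.orderedExpRing.Theory}
    (hR : Language.Theory.isModelComplete_iff_forall_exists_isExistential (T := T₀))
    (hT₀ : T₀ ⊆ realExpTheory) (hmc : T₀.IsModelComplete) :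
    ∀ φ ∈ realExpTheory, (T₀ ∪ realExpExistentialTheory) ⊨ᵇ φ :=
  realExpTheory_models_of_forall_iff_isExistential hT₀
    (Language.Theory.forall_sentence_iff_isExistential_of_formula (hR.1 hmc 0))

/-- **Macintyre–Wilkie's route to decidability, skeleton.** Granted Janiczak's theorem (C9): if
`T₀ ⊆ Th(ℝ_exp)` is a recursive set of sentences such that `T₀ ∪ Th_∃(ℝ_exp) ⊨ Th(ℝ_exp)`, and
`Th_∃(ℝ_exp)` is computably axiomatizable, then `Th(ℝ_exp)` is decidable
(`Language.orderedExpRing` is recursively presented: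
`Language.orderedExpRing.isRecursivelyPresented`). [folklore] -/
theorem realExpDecidable_of_recursive_subtheory
    (hJ : Language.Theory.isDecidable_of_isComplete_of_isComputablyAxiomatizable
      (L := Language.orderedExpRing))
    {T₀ : Language.orderedExpRing.Theory} (hT₀ : T₀ ⊆ realExpTheory) (hrec : T₀.IsRecursive)
    (hgen : ∀ φ ∈ realExpTheory, (T₀ ∪ realExpExistentialTheory) ⊨ᵇ φ)
    (hE : realExpExistentialTheory.IsComputablyAxiomatizable) : RealExpDecidable :=
  Language.Theory.isDecidable_completeTheory_of_union hJ
    Language.orderedExpRing.isRecursivelyPresented hT₀ hrec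
    realExpExistentialTheory_subset_realExpTheory hE hgen

/-- The skeleton with a recursive *model complete* subtheory (granted Robinson's test, C7, and
Janiczak's theorem, C9). [folklore] -/
theorem realExpDecidable_of_recursive_modelComplete_subtheory
    (hJ : Language.Theory.isDecidable_of_isComplete_of_isComputablyAxiomatizable
      (L := Language.orderedExpRing))
    {T₀ : Language.orderedExpRing.Theory}
    (hR : Language.Theory.isModelComplete_iff_forall_exists_isExistential (T := T₀))
    (hT₀ : T₀ ⊆ realExpTheory) (hrec : T₀.IsRecursive) (hmc : T₀.IsModelComplete)
    (hE : realExpExistentialTheory.IsComputablyAxiomatizable) : RealExpDecidable :=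
  realExpDecidable_of_recursive_subtheory hJ hT₀ hrec
    (realExpTheory_models_of_isModelComplete hR hT₀ hmc) hE

/-- The direction `←` of the unconditional half from a recursive subtheory `T₀ ⊆ Th(ℝ_exp)` with
`T₀ ∪ Th_∃(ℝ_exp) ⊨ Th(ℝ_exp)` (granted Janiczak's theorem, C9). [folklore] -/
theorem macintyreWilkie_iff_mpr_of_recursive_subtheory
    (hJ : Language.Theory.isDecidable_of_isComplete_of_isComputablyAxiomatizable
      (L := Language.orderedExpRing))
    {T₀ : Language.orderedExpRing.Theory} (hT₀ : T₀ ⊆ realExpTheory) (hrec : T₀.IsRecursive)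
    (hgen : ∀ φ ∈ realExpTheory, (T₀ ∪ realExpExistentialTheory) ⊨ᵇ φ) :
    realExpExistentialTheory.IsComputablyAxiomatizable → RealExpDecidable :=
  realExpDecidable_of_recursive_subtheory hJ hT₀ hrec hgen

/-- The direction `→` of the unconditional half, granted that existential sentences of
`Language.orderedExpRing` are recognizable from their Gödel numbers: if `Th(ℝ_exp)` is
decidable then `Th_∃(ℝ_exp)` is a recursive set of sentences. [folklore] -/
theorem realExpExistentialTheory_isRecursive_of_realExpDecidable
    (hEx : ComputablePred fun n : ℕ => ∃ φ : Language.orderedExpRing.Sentence,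
      Language.BoundedFormula.IsExistential φ ∧ φ.godelNumber = n)
    (h : RealExpDecidable) : realExpExistentialTheory.IsRecursive :=
  Language.Theory.isRecursive_existentialTheory_of_isDecidable hEx h

/-- The direction `→` of the unconditional half, granted recognizability of existential
sentences: decidability of `Th(ℝ_exp)` makes `Th_∃(ℝ_exp)` computably axiomatizable. [folklore] -/
theorem macintyreWilkie_iff_mp_of_computablePred_isExistential
    (hEx : ComputablePred fun n : ℕ => ∃ φ : Language.orderedExpRing.Sentence,
      Language.BoundedFormula.IsExistential φ ∧ φ.godelNumber = n) :
    RealExpDecidable → realExpExistentialTheory.IsComputablyAxiomatizable :=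
  fun h => (realExpExistentialTheory_isRecursive_of_realExpDecidable hEx h).isComputablyAxiomatizable

/-- The unconditional half assembled from its two directions' inputs: a recursive `T₀ ⊆ Th(ℝ_exp)`
with `T₀ ∪ Th_∃(ℝ_exp) ⊨ Th(ℝ_exp)`, Janiczak's theorem, and recognizability of existential
sentences. [folklore] -/
theorem macintyreWilkie_realExpDecidable_iff_existential_of_recursive_subtheory
    (hJ : Language.Theory.isDecidable_of_isComplete_of_isComputablyAxiomatizable
      (L := Language.orderedExpRing))
    (hEx : ComputablePred fun n : ℕ => ∃ φ : Language.orderedExpRing.Sentence,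
      Language.BoundedFormula.IsExistential φ ∧ φ.godelNumber = n)
    {T₀ : Language.orderedExpRing.Theory} (hT₀ : T₀ ⊆ realExpTheory) (hrec : T₀.IsRecursive)
    (hgen : ∀ φ ∈ realExpTheory, (T₀ ∪ realExpExistentialTheory) ⊨ᵇ φ) :
    macintyreWilkie_realExpDecidable_iff_existential :=
  ⟨macintyreWilkie_iff_mp_of_computablePred_isExistential hEx,
    macintyreWilkie_iff_mpr_of_recursive_subtheory hJ hT₀ hrec hgen⟩

/-- **Macintyre–Wilkie's Theorem 1.1 along their route, skeleton.** Granted Janiczak's theorem: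
a recursive `T₀ ⊆ Th(ℝ_exp)` with `T₀ ∪ Th_∃(ℝ_exp) ⊨ Th(ℝ_exp)` (the unconditional, effective
model completeness half) and the Schanuel-conditional computable axiomatizability of
`Th_∃(ℝ_exp)` (the conditional half) give `Literature.ModelTheory.ExponentialFields.macintyre_wilkie`. [cite: MacintyreWilkieKreiseliana1996, Thm. 1.1] -/
theorem macintyre_wilkie_of_recursive_subtheory
    (hJ : Language.Theory.isDecidable_of_isComplete_of_isComputablyAxiomatizable
      (L := Language.orderedExpRing))
    {T₀ : Language.orderedExpRing.Theory} (hT₀ : T₀ ⊆ realExpTheory) (hrec : T₀.IsRecursive)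
    (hgen : ∀ φ ∈ realExpTheory, (T₀ ∪ realExpExistentialTheory) ⊨ᵇ φ)
    (hB : macintyreWilkie_existential_of_schanuelProperty) : macintyre_wilkie :=
  fun h => realExpDecidable_of_recursive_subtheory hJ hT₀ hrec hgen (hB h)

/-! #### With Janiczak's theorem discharged -/

/-- Janiczak's theorem (the named fact `Theory.isDecidable_of_isComplete_of_isComputablyAxiomatizable`
of `DecidableTheory.lean`) is proved in `DecidableTheoryProofs.lean`
(`…_holds`); hence the skeleton holds without that hypothesis: a recursive
`T₀ ⊆ Th(ℝ_exp)` with `T₀ ∪ Th_∃(ℝ_exp) ⊨ Th(ℝ_exp)` and the computable axiomatizability of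
`Th_∃(ℝ_exp)` give the decidability of `Th(ℝ_exp)`. [folklore] -/
theorem realExpDecidable_of_recursive_subtheory'
    {T₀ : Language.orderedExpRing.Theory} (hT₀ : T₀ ⊆ realExpTheory) (hrec : T₀.IsRecursive)
    (hgen : ∀ φ ∈ realExpTheory, (T₀ ∪ realExpExistentialTheory) ⊨ᵇ φ)
    (hE : realExpExistentialTheory.IsComputablyAxiomatizable) : RealExpDecidable :=
  realExpDecidable_of_recursive_subtheory
    Language.Theory.isDecidable_of_isComplete_of_isComputablyAxiomatizable_holds hT₀ hrec hgen hE

/-- **Macintyre–Wilkie's Theorem 1.1 along their route** (Janiczak discharged): the unconditional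
input — a recursive `T₀ ⊆ Th(ℝ_exp)` with `T₀ ∪ Th_∃(ℝ_exp) ⊨ Th(ℝ_exp)` — and the conditional
half give `Literature.ModelTheory.ExponentialFields.macintyre_wilkie`. [cite: MacintyreWilkieKreiseliana1996, Thm. 1.1] -/
theorem macintyre_wilkie_of_recursive_subtheory'
    {T₀ : Language.orderedExpRing.Theory} (hT₀ : T₀ ⊆ realExpTheory) (hrec : T₀.IsRecursive)
    (hgen : ∀ φ ∈ realExpTheory, (T₀ ∪ realExpExistentialTheory) ⊨ᵇ φ)
    (hB : macintyreWilkie_existential_of_schanuelProperty) : macintyre_wilkie :=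
  fun h => realExpDecidable_of_recursive_subtheory' hT₀ hrec hgen (hB h)

/-- The direction `←` of the unconditional half from a recursive subtheory, Janiczak
discharged. [folklore] -/
theorem macintyreWilkie_iff_mpr_of_recursive_subtheory'
    {T₀ : Language.orderedExpRing.Theory} (hT₀ : T₀ ⊆ realExpTheory) (hrec : T₀.IsRecursive)
    (hgen : ∀ φ ∈ realExpTheory, (T₀ ∪ realExpExistentialTheory) ⊨ᵇ φ) :
    realExpExistentialTheory.IsComputablyAxiomatizable → RealExpDecidable :=
  realExpDecidable_of_recursive_subtheory' hT₀ hrec hgen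

/-- The sentence-code recogniser of `ProofTheory/SentenceCodes.lean` for the language of
`ℝ_exp`: the set of Gödel numbers of `Language.orderedExpRing`-sentences is computable. [folklore] -/
theorem computablePred_exists_godelNumber_eq_orderedExpRing :
    ComputablePred fun n : ℕ => ∃ φ : Language.orderedExpRing.Sentence, φ.godelNumber = n :=
  Literature.ModelTheory.ProofTheory.PreFOL.computablePred_exists_godelNumber_eq
    Language.orderedExpRing.isRecursivelyPresented.computable_arityF
    Language.orderedExpRing.isRecursivelyPresented.computable_arityR

/-- The existential-sentence recogniser of `ProofTheory/ExistentialCodes.lean` for the language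
of `ℝ_exp`: the set of Gödel numbers of existential `Language.orderedExpRing`-sentences is
computable. [folklore] -/
theorem computablePred_exists_isExistential_godelNumber_eq_orderedExpRing :
    ComputablePred fun n : ℕ => ∃ φ : Language.orderedExpRing.Sentence,
      Language.BoundedFormula.IsExistential φ ∧ φ.godelNumber = n :=
  Literature.ModelTheory.ProofTheory.PreFOL.computablePred_exists_isExistential_godelNumber_eq
    Language.orderedExpRing.isRecursivelyPresented.computable_arityF
    Language.orderedExpRing.isRecursivelyPresented.computable_arityR

/-- **The direction `→` of the unconditional half, proved**: if `Th(ℝ_exp)` is decidable then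
`Th_∃(ℝ_exp)` is a recursive set of sentences. [folklore] -/
theorem realExpExistentialTheory_isRecursive_of_realExpDecidable' (h : RealExpDecidable) :
    realExpExistentialTheory.IsRecursive :=
  realExpExistentialTheory_isRecursive_of_realExpDecidable
    computablePred_exists_isExistential_godelNumber_eq_orderedExpRing h

/-- **The direction `→` of `macintyreWilkie_realExpDecidable_iff_existential`, proved**:
decidability of `Th(ℝ_exp)` makes `Th_∃(ℝ_exp)` computably axiomatizable. [folklore] -/
theorem macintyreWilkie_iff_mp :
    RealExpDecidable → realExpExistentialTheory.IsComputablyAxiomatizable :=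
  macintyreWilkie_iff_mp_of_computablePred_isExistential
    computablePred_exists_isExistential_godelNumber_eq_orderedExpRing

/-- **The unconditional half from Macintyre–Wilkie's recursive subtheory alone**: a recursive
`T₀ ⊆ Th(ℝ_exp)` with `T₀ ∪ Th_∃(ℝ_exp) ⊨ Th(ℝ_exp)` (what their effective model completeness
provides) yields the named fact `macintyreWilkie_realExpDecidable_iff_existential` — Janiczak's
theorem and the recognisability of (existential) sentences being now theorems of the tree. [cite: MacintyreWilkieKreiseliana1996] -/
theorem macintyreWilkie_realExpDecidable_iff_existential_of_recursive_subtheory'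
    {T₀ : Language.orderedExpRing.Theory} (hT₀ : T₀ ⊆ realExpTheory) (hrec : T₀.IsRecursive)
    (hgen : ∀ φ ∈ realExpTheory, (T₀ ∪ realExpExistentialTheory) ⊨ᵇ φ) :
    macintyreWilkie_realExpDecidable_iff_existential :=
  ⟨macintyreWilkie_iff_mp, macintyreWilkie_iff_mpr_of_recursive_subtheory' hT₀ hrec hgen⟩

/-! #### The r.e. reading of the two halves -/

/-- `Th_∃(ℝ_exp)` is computably axiomatizable iff it is r.e. (Craig's theorem and the
enumerability theorem). [folklore] -/
theorem realExpExistentialTheory_isComputablyAxiomatizable_iff_isREAxioms :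
    realExpExistentialTheory.IsComputablyAxiomatizable ↔ realExpExistentialTheory.IsREAxioms :=
  Language.Theory.isComputablyAxiomatizable_existentialTheory_iff_isREAxioms
    Language.orderedExpRing.isRecursivelyPresented

/-- The unconditional half in the r.e. reading ("`Th(ℝ_exp)` is decidable iff its existential
theory is recursively enumerable", the form in Wilkie's 1997 survey as summarised in
Zbl 0888.03022) is equivalent to the vendored form. [folklore] -/
theorem macintyreWilkie_realExpDecidable_iff_existential_iff_re :
    macintyreWilkie_realExpDecidable_iff_existential ↔
      (RealExpDecidable ↔ realExpExistentialTheory.IsREAxioms) := by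
  unfold macintyreWilkie_realExpDecidable_iff_existential
  rw [realExpExistentialTheory_isComputablyAxiomatizable_iff_isREAxioms]

/-- The conditional half in the r.e. reading ("under Schanuel's conjecture the existential theory
of `ℝ_exp` is recursively enumerable") is equivalent to the vendored form. [folklore] -/
theorem macintyreWilkie_existential_of_schanuelProperty_iff_re :
    macintyreWilkie_existential_of_schanuelProperty ↔
      (SchanuelProperty ℝ → realExpExistentialTheory.IsREAxioms) := by
  unfold macintyreWilkie_existential_of_schanuelProperty
  rw [realExpExistentialTheory_isComputablyAxiomatizable_iff_isREAxioms]

/-! #### With Robinson's test discharged -/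

/-- The Robinson step for `ℝ_exp` from a model complete subtheory, Robinson's test being proved
(`ExistentialPreservation.lean`). [cite: Marker2002, Prop. 3.1.12] -/
theorem realExpTheory_models_of_isModelComplete' {T₀ : Language.orderedExpRing.Theory}
    (hT₀ : T₀ ⊆ realExpTheory) (hmc : T₀.IsModelComplete) :
    ∀ φ ∈ realExpTheory, (T₀ ∪ realExpExistentialTheory) ⊨ᵇ φ :=
  realExpTheory_models_of_isModelComplete
    Language.Theory.isModelComplete_iff_forall_exists_isExistential_holds hT₀ hmc

/-- **Macintyre–Wilkie's route, all logic discharged**: a *recursive, model complete* subtheory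
`T₀ ⊆ Th(ℝ_exp)` (what an effective version of Wilkie's theorem provides) together with the
computable axiomatizability of `Th_∃(ℝ_exp)` makes `Th(ℝ_exp)` decidable — Robinson's test,
Janiczak's theorem and the recognisability of sentences being theorems of the tree. [folklore] -/
theorem realExpDecidable_of_recursive_modelComplete_subtheory'
    {T₀ : Language.orderedExpRing.Theory} (hT₀ : T₀ ⊆ realExpTheory) (hrec : T₀.IsRecursive)
    (hmc : T₀.IsModelComplete) (hE : realExpExistentialTheory.IsComputablyAxiomatizable) :
    RealExpDecidable :=
  realExpDecidable_of_recursive_subtheory' hT₀ hrec (realExpTheory_models_of_isModelComplete' hT₀ hmc) hE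

/-- The unconditional half of Macintyre–Wilkie from a recursive model complete subtheory of
`Th(ℝ_exp)` alone. [cite: MacintyreWilkieKreiseliana1996] -/
theorem macintyreWilkie_realExpDecidable_iff_existential_of_recursive_modelComplete_subtheory
    {T₀ : Language.orderedExpRing.Theory} (hT₀ : T₀ ⊆ realExpTheory) (hrec : T₀.IsRecursive)
    (hmc : T₀.IsModelComplete) : macintyreWilkie_realExpDecidable_iff_existential :=
  macintyreWilkie_realExpDecidable_iff_existential_of_recursive_subtheory' hT₀ hrec
    (realExpTheory_models_of_isModelComplete' hT₀ hmc)

/-- **`Literature.ModelTheory.ExponentialFields.macintyre_wilkie` from a recursive model complete subtheory and the conditional half**,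
all logic discharged. [cite: MacintyreWilkieKreiseliana1996, Thm. 1.1] -/
theorem macintyre_wilkie_of_recursive_modelComplete_subtheory
    {T₀ : Language.orderedExpRing.Theory} (hT₀ : T₀ ⊆ realExpTheory) (hrec : T₀.IsRecursive)
    (hmc : T₀.IsModelComplete) (hB : macintyreWilkie_existential_of_schanuelProperty) :
    macintyre_wilkie :=
  macintyre_wilkie_of_recursive_subtheory' hT₀ hrec (realExpTheory_models_of_isModelComplete' hT₀ hmc) hB


/-! #### The unconditional half in the form in which it is proved: a recursive subtheory -/

/-- **Macintyre–Wilkie 1996, effective model completeness — the unconditional half in the form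
their proof provides.** There is a *recursive* set `T₀` of sentences true in `ℝ_exp` which
together with the existential theory axiomatizes the complete theory: `T₀ ⊆ Th(ℝ_exp)`, `T₀` is
recursive, and `T₀ ∪ Th_∃(ℝ_exp) ⊨ Th(ℝ_exp)`.

In Macintyre–Wilkie's paper `T₀` is an explicit recursively axiomatized theory, extracted from
Wilkie's proof of the model completeness of restricted exponentiation made effective (Khovanskii
bounds) together with the passage from the restricted to the unrestricted exponential; only its
*existence* is vendored here, the primary source not being held (its axioms are therefore not
transcribed). Printed support: Jones–Servi 2011, whose proof "proceeds as in [MW96]" (§1), §2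
("We show the effective model-completeness of `Th(ℝ^α_res)`, i.e. we exhibit a recursively
axiomatized subtheory `T_res`, which is model-complete"; Thm. 2.5, "See also [MW96, pag. 448]")
and §3, Prop. 3.1: "`T ∪ ∃Th(ℝ^α) ⊢ Th(ℝ^α)`" for their recursive subtheory `T ⊆ Th(ℝ^α)`
(Def. 1.2), introduced by "in order to prove the decidability of `Th(ℝ^α)`, it is enough to
recursively axiomatize its existential fragment"; Wilkie 1997 (Zbl 0888.03022): Wilkie's model
completeness proof is sufficiently constructive that "the question of decidability of `T_exp` is
reduced to the question of the decidability of the existential theory"; Bianconi 2014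
(arXiv:1410.7191), p. 9: in [MW96] "they prove an effective model completeness result for the
expansion of the real field with the restricted exponential function". This is exactly the input
of the proved skeleton `realExpDecidable_of_recursive_subtheory'`: it yields the unconditional
half `macintyreWilkie_realExpDecidable_iff_existential` outright
(`macintyreWilkie_realExpDecidable_iff_existential_of_recursiveSubtheory`, proved below), and a
recursive *model complete* subtheory of `Th(ℝ_exp)` is a witness
(`macintyreWilkie_recursiveSubtheory_of_isModelComplete`, proved below by Robinson's test).
A named fact (`def … : Prop`), not yet proved here. [cite: MacintyreWilkieKreiseliana1996, p. 448] [cite: JonesServi2011, Prop. 3.1] -/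
def macintyreWilkie_recursiveSubtheory : Prop :=
  ∃ T₀ : Language.orderedExpRing.Theory, T₀ ⊆ realExpTheory ∧ T₀.IsRecursive ∧
    ∀ φ ∈ realExpTheory, (T₀ ∪ realExpExistentialTheory) ⊨ᵇ φ

/-- A recursive model complete subtheory of `Th(ℝ_exp)` witnesses
`macintyreWilkie_recursiveSubtheory` (Robinson's test, proved in
`ExistentialPreservation.lean`). [folklore] -/
theorem macintyreWilkie_recursiveSubtheory_of_isModelComplete
    {T₀ : Language.orderedExpRing.Theory} (hT₀ : T₀ ⊆ realExpTheory) (hrec : T₀.IsRecursive)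
    (hmc : T₀.IsModelComplete) : macintyreWilkie_recursiveSubtheory :=
  ⟨T₀, hT₀, hrec, realExpTheory_models_of_isModelComplete' hT₀ hmc⟩

/-- **The unconditional half of Macintyre–Wilkie from their recursive subtheory** (all logic —
Janiczak's theorem, the recognisability of existential sentences — being proved in the tree):
`Th(ℝ_exp)` is decidable iff `Th_∃(ℝ_exp)` is computably axiomatizable. [cite: MacintyreWilkieKreiseliana1996, p. 448] -/
theorem macintyreWilkie_realExpDecidable_iff_existential_of_recursiveSubtheory
    (h : macintyreWilkie_recursiveSubtheory) :
    macintyreWilkie_realExpDecidable_iff_existential := by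
  obtain ⟨T₀, hT₀, hrec, hgen⟩ := h
  exact macintyreWilkie_realExpDecidable_iff_existential_of_recursive_subtheory' hT₀ hrec hgen

/-- **`Literature.ModelTheory.ExponentialFields.macintyre_wilkie` from the recursive subtheory and the conditional half.** [cite: MacintyreWilkieKreiseliana1996, Thm. 1.1] -/
theorem macintyre_wilkie_of_recursiveSubtheory (h : macintyreWilkie_recursiveSubtheory)
    (hB : macintyreWilkie_existential_of_schanuelProperty) : macintyre_wilkie :=
  macintyre_wilkie_of_parts
    (macintyreWilkie_realExpDecidable_iff_existential_of_recursiveSubtheory h) hB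

/-- Given the recursive subtheory, the conditional half and Macintyre–Wilkie's theorem itself are
equivalent statements: what remains of `Literature.ModelTheory.ExponentialFields.macintyre_wilkie` beyond
`macintyreWilkie_recursiveSubtheory` is precisely the Schanuel-conditional computable
axiomatizability of `Th_∃(ℝ_exp)`. [folklore] -/
theorem macintyreWilkie_existential_of_schanuelProperty_iff_macintyre_wilkie
    (h : macintyreWilkie_recursiveSubtheory) :
    macintyreWilkie_existential_of_schanuelProperty ↔ macintyre_wilkie :=
  ⟨macintyre_wilkie_of_recursiveSubtheory h,
    macintyreWilkie_existential_of_schanuelProperty_of_macintyre_wilkie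
      (macintyreWilkie_realExpDecidable_iff_existential_of_recursiveSubtheory h)⟩

/-- **A complete recursive axiomatization.** If every existential sentence true in `ℝ_exp` is a
consequence of some recursive set `T₁` of sentences true in `ℝ_exp` (in Macintyre–Wilkie's
proof, under Schanuel's conjecture: of their recursive subtheory itself — the form of the
conditional half mirrored in Jones–Servi 2011, Thm. 3.11: "Assume that `α` is generic. Let
`g ∈ M_n(ℤ[α])` be such that `ℝ^α ⊨ ∃x̄ g(x̄) = 0`. Then `T ⊢ ∃x̄ g(x̄) = 0`"), then together
with the recursive subtheory `T₀` of `macintyreWilkie_recursiveSubtheory` the union `T₀ ∪ T₁`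
is a recursive set of true axioms for `Th(ℝ_exp)` (compare Berarducci–Servi 2004, p. 45:
"another candidate for a recursive axiomatization of `T_exp`, after the one considered in
[8]"). [cite: JonesServi2011, Thm. 3.11] -/
theorem realExpTheory_exists_recursive_axiomatization
    (h : macintyreWilkie_recursiveSubtheory)
    (h₁ : ∃ T₁ : Language.orderedExpRing.Theory, T₁ ⊆ realExpTheory ∧ T₁.IsRecursive ∧
      ∀ φ ∈ realExpExistentialTheory, T₁ ⊨ᵇ φ) :
    ∃ T : Language.orderedExpRing.Theory, T ⊆ realExpTheory ∧ T.IsRecursive ∧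
      ∀ φ ∈ realExpTheory, T ⊨ᵇ φ := by
  obtain ⟨T₀, hT₀, hrec₀, hgen⟩ := h
  obtain ⟨T₁, hT₁, hrec₁, hE⟩ := h₁
  refine ⟨T₀ ∪ T₁, Set.union_subset hT₀ hT₁, hrec₀.union hrec₁, fun φ hφ => ?_⟩
  refine Language.Theory.models_of_models_theory (fun ψ hψ => ?_) (hgen φ hφ)
  rcases hψ with hψ | hψ
  · exact Language.Theory.models_sentence_of_mem (Set.mem_union_left _ hψ)
  · exact Language.Theory.models_sentence_mono Set.subset_union_right (hE ψ hψ)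

/-- A complete theory containing a recursive set of axioms for itself is decidable (Janiczak's
theorem, proved in `DecidableTheoryProofs.lean`): if some recursive `T ⊆ Th(ℝ_exp)` has
`T ⊨ Th(ℝ_exp)`, then `Th(ℝ_exp)` is decidable. [folklore] -/
theorem realExpDecidable_of_exists_recursive_axiomatization
    (h : ∃ T : Language.orderedExpRing.Theory, T ⊆ realExpTheory ∧ T.IsRecursive ∧
      ∀ φ ∈ realExpTheory, T ⊨ᵇ φ) : RealExpDecidable := by
  obtain ⟨T, hT, hrec, hgen⟩ := h
  exact Language.Theory.isDecidable_completeTheory_of_union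
    Language.Theory.isDecidable_of_isComplete_of_isComputablyAxiomatizable_holds
    Language.orderedExpRing.isRecursivelyPresented hT hrec hT hrec.isComputablyAxiomatizable
    fun φ hφ => Language.Theory.models_sentence_mono Set.subset_union_left (hgen φ hφ)

/-- Conversely, a decidable `Th(ℝ_exp)` is itself a recursive set of axioms for itself; so
"`Th(ℝ_exp)` is axiomatized by a recursive set of true sentences" is equivalent to
`RealExpDecidable`. [folklore] -/
theorem realExpDecidable_iff_exists_recursive_axiomatization :
    RealExpDecidable ↔ ∃ T : Language.orderedExpRing.Theory, T ⊆ realExpTheory ∧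
      T.IsRecursive ∧ ∀ φ ∈ realExpTheory, T ⊨ᵇ φ :=
  ⟨fun h => ⟨realExpTheory, subset_rfl, realExpDecidable_iff_isRecursive.1 h,
      fun _ hφ => Language.Theory.models_sentence_of_mem hφ⟩,
    realExpDecidable_of_exists_recursive_axiomatization⟩

/-- **Macintyre–Wilkie's Theorem 1.1 along the route of their proof**: the recursive subtheory
(unconditional) and, under the Schanuel property, the derivability of every true existential
sentence from a recursive set of true sentences give the decidability of `Th(ℝ_exp)` under the
Schanuel property. [cite: MacintyreWilkieKreiseliana1996, Thm. 1.1] -/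
theorem macintyre_wilkie_of_recursiveSubtheory_of_existential_consequences
    (h : macintyreWilkie_recursiveSubtheory)
    (h₁ : SchanuelProperty ℝ → ∃ T₁ : Language.orderedExpRing.Theory, T₁ ⊆ realExpTheory ∧
      T₁.IsRecursive ∧ ∀ φ ∈ realExpExistentialTheory, T₁ ⊨ᵇ φ) :
    macintyre_wilkie := fun hS =>
  realExpDecidable_of_exists_recursive_axiomatization
    (realExpTheory_exists_recursive_axiomatization h (h₁ hS))

end Literature.ModelTheory.ExponentialFields

end
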